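import Summits.NavierStokesRegularity.FluidComputer.PalasekTowerClayBridgePathB
import Summits.NavierStokesRegularity.FluidComputer.PalasekTowerViscosity
import HarnessLib

/-!
# The generic E–C closer: ANY designed forced blow-up with a Clay-class force gives Clay (C)

Cell `ns-blowup`, seat `ns-blowup-ecbridge-2` (g3; the E–C endpoint theory seat). LABEL: E–C typing
(KERNEL). WHAT THIS IS NOT: not Navier–Stokes evidence — nothing is constructed; the structure below
is a TYPE (no instance is claimed anywhere) and the theorems say what ONE inhabitant at ONE viscosity
would give. Companion memo: `run/shared/lean/pub/ns-blowup/ecbridge2/ECBRIDGE-2-MEMO-2.md`.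

## Why this file (the question «can the E–C force be C^∞ THROUGH T*», answered at the level of types)

The cell's E–C bridge of record (`PalasekTowerClayBridgePathB.navierStokesBreakdownR3_of_step2_B`,
seats ecbridge-1 and ecbridge-2, lean g3 and g4) closes Fefferman's (C) from the TOWER interface `Realisation ν R`.
Its proof uses only five properties of a realisation, none of them tower-specific: (i) `(u, p)` is an
exact classical solution of the FORCED system on `[0, T) × ℝ³`; (ii) the datum `u 0` and the force
`f` are of Clay class — `f` smooth on the CLOSED half-space `[0, ∞) × ℝ³`, i.e. THROUGH the blow-up
time, with Fefferman's decay (5); (iii) finite energy and (iv) boundedness of `u` on every closed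
sub-slab `[0, T']`, `T' < T` (so `u ∈ L⁴(0,T';L⁶)`, the Serrin class in which the tree's forced
weak–strong uniqueness `serrinMasuda_weak_strong_uniqueness_forced_L4L6` pins every Clay competitor
to `u`); (v) NO classical extension past `T` (`¬ HasSmoothExtensionPast`). This file isolates that
content as the structure `DesignedBlowup ν` and proves

* `DesignedBlowup.not_exists_claySolution` — no global Clay-class solution shares the datum and the
  force of a designed blow-up (competitor `=` design on `[0, T)` by PATH B′, hence the competitor's
  restriction to `[0, T+1)` is a classical extension past `T`, which (v) forbids);
* `DesignedBlowup.rescale` — ONE viscosity gives ALL (time dilation `u ↦ a·u(a t, ·)`, `a = ν/μ`,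
  tree `isClassicalNSSolutionOn_viscosityChange` + `hasRapidSpaceTimeDecay_timeRescale`; maximality
  is transported by dilating a putative extension back);
* `navierStokesBreakdownR3_of_designedBlowup` — **`DesignedBlowup μ → NavierStokesBreakdownR3`** for
  any single `μ > 0` (and the `∀ ν` / Literature spellings);
* `DesignedBlowup.ofUnboundedOn` — the pointwise blow-up witness used by every construction seat
  (`u` unbounded on `[0, T) × K` for a compact `K`) implies (v);
* `Realisation.toDesignedBlowup` — the tower interface IS a designed blow-up, and the bridge of
  record factors: `navierStokesBreakdownR3_of_step2_designed`.

THE E–C READING (memo §2, style (β′) «formal blow-up»): for a DESIGNED pair `(U, P)`, smooth on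
`[0, T) × ℝ³`, put `g := ∂ₜU + (U·∇)U − νΔU + ∇P` (its Navier–Stokes residual). Then `(U, P)` is an
exact classical solution of the system forced by `g`, and clause (ii) asks exactly that `g` be the
restriction of a Clay-class force `f` on `[0, ∞) × ℝ³` — i.e. that the residual be `C^∞` THROUGH `T`
with decay. At a singular point this forces the residual to be FLAT there (all derivatives of the
singular part of `NS(U)` cancel): `U` solves Navier–Stokes to INFINITE ORDER at the singularity. So
(C) follows from an ALL-ORDERS formal blow-up and NO nonlinear stability theorem — the precise sense in
which (C) is cheaper than (A) — while every finite-order design leaves a residual outside the Clay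
class (the tree's `IsSelfSimilarEulerProfile.ns_defect_selfSimilarCollapse`: the raw Euler-window
ansatz has defect `−ν(T−t)^{−1−γ}ΔU`, unbounded for every `γ`; T22/T23 of the cell's KILLSHEET are the
order-0 failures of the cut-off and prescribed-velocity designs).

References: C. L. Fefferman, Clay problem description, (C) with (4)–(7) [cite: FeffermanClay2006, (C)];
T. Tao, Anal. PDE 6 (2013) = arXiv:1108.1165, footnote 3 (viscosity scaling), Lemma 4.1 [cite: Tao2011, footnote 3];
H. Sohr, *The Navier–Stokes equations* (2001), Thm. V.1.5.1 (Serrin–Masuda weak–strong uniqueness)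
[cite: Sohr2001, Thm. V.1.5.1]; J. T. Beale, T. Kato, A. Majda, Comm. Math. Phys. 94 (1984) §1
(continuation vocabulary) [cite: BealeKatoMajda1984, §1].
-/

noncomputable section

namespace Summit.NavierStokesRegularity.FluidComputer

open Set MeasureTheory Filter Topology Function
open scoped ENNReal ContDiff NNReal
open Literature.Analysis.FluidPDE
open Summit.NavierStokesRegularity.NavierStokesRegularity
open Summit.NavierStokesRegularity.NavierStokesRegularity.Theorems
open Summit.NavierStokesRegularity.FluidComputer.PalasekTowerClayBridge

/-! ## §1 The type of a designed forced blow-up -/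

/-- **A designed forced blow-up at viscosity `ν`** (the hypotheses of the E–C closer, and nothing
else): a blow-up time `T > 0`; an exact classical solution `(u, p)` of
`∂ₜu + (u·∇)u = νΔu − ∇p + f`, `div u = 0` on `[0, T) × ℝ³` admitting NO classical extension past
`T`; Clay datum (Fefferman (4)) and Clay force — `f ∈ C^∞([0, ∞) × ℝ³)`, smooth THROUGH `T`, with the
space-time decay (5); finite energy and a uniform velocity bound on every closed sub-slab `[0, T']`,
`T' < T`. In the designed-velocity reading `f|[0,T)` is the Navier–Stokes residual of `(u, p)`.
A TYPE; no inhabitant is asserted anywhere in the tree. [cite: FeffermanClay2006, (C) (4) (5) (6)] -/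
structure DesignedBlowup (ν : ℝ) where
  /-- the blow-up time -/
  T : ℝ
  T_pos : 0 < T
  /-- velocity on `[0, T) × ℝ³` (values for `t ≥ T` are irrelevant) -/
  u : ℝ → EuclideanSpace ℝ (Fin 3) → EuclideanSpace ℝ (Fin 3)
  /-- pressure -/
  p : ℝ → EuclideanSpace ℝ (Fin 3) → ℝ
  /-- the force, on all of `[0, ∞) × ℝ³` -/
  f : ℝ → EuclideanSpace ℝ (Fin 3) → EuclideanSpace ℝ (Fin 3)
  /-- exact classical forced Navier–Stokes on `[0, T)` -/
  classical : IsClassicalNSSolutionOn (Ico 0 T) ν f u p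
  /-- `T` is the lifespan: no classical solution on a longer `[0, T')` agrees with `u` on `[0, T)` -/
  no_extension : ¬ HasSmoothExtensionPast ν f u T
  /-- Clay datum (4) -/
  datum_decay : HasRapidSpatialDecay (u 0)
  /-- Clay force (6): smooth on the closed half-space, in particular THROUGH `T` -/
  force_smooth : IsSmoothOnHalfSpace f
  /-- Clay force (5) -/
  force_decay : HasRapidSpaceTimeDecay f
  /-- finite energy on every closed sub-slab before `T` -/
  energy : ∀ T', T' < T → ∃ C : ℝ≥0∞, C < ⊤ ∧ ∀ t ∈ Icc 0 T', ∫⁻ x, ‖u t x‖ₑ ^ 2 ≤ C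
  /-- a uniform velocity bound on every closed sub-slab before `T` -/
  bounded : ∀ T', T' < T → ∃ B : ℝ, ∀ t ∈ Icc 0 T', ∀ x, ‖u t x‖ ≤ B

namespace DesignedBlowup

variable {ν : ℝ} (D : DesignedBlowup ν)

/-! ## §2 Bookkeeping -/

/-- A designed blow-up is a maximal smooth solution with lifespan `T` (Beale–Kato–Majda
vocabulary). [cite: BealeKatoMajda1984, §1] -/
theorem isMaximalSmoothSolution : IsMaximalSmoothSolution ν D.f D.u D.p D.T :=
  ⟨D.classical, D.no_extension⟩

/-- The datum of a designed blow-up is smooth. [folklore] -/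
theorem contDiff_datum : ContDiff ℝ ∞ (D.u 0) :=
  D.classical.contDiff_velocity (t := 0) ⟨le_rfl, D.T_pos⟩

/-- The datum of a designed blow-up is divergence free. [folklore] -/
theorem divFree_datum : NSWave0.IsDivFree (D.u 0) :=
  D.classical.divFree 0 ⟨le_rfl, D.T_pos⟩

/-- The designed solution lies in `L⁴(0, T''; L⁶)` for every `T'' ≤ T' < T` (bounded with finite
energy on `[0, T']`; `memLqLp_four_six_of_bounded`). [folklore] -/
theorem memLqLp_four_six {T' : ℝ} (hT' : T' < D.T) {T'' : ℝ} (hT'' : T'' ≤ T') :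
    MemLqLp 4 6 D.u (Ioo 0 T'') := by
  obtain ⟨B, hB⟩ := D.bounded T' hT'
  obtain ⟨A, hAt, hA⟩ := D.energy T' hT'
  have hsub : Icc 0 T'' ⊆ Icc 0 T' := Icc_subset_Icc le_rfl hT''
  refine memLqLp_four_six_of_bounded (fun t ht => ?_) (fun t ht => hB t (hsub ht)) hAt.ne
    (fun t ht => hA t (hsub ht))
  exact (D.classical.contDiff_velocity ⟨ht.1, lt_of_le_of_lt (ht.2.trans hT'') hT'⟩).continuous

/-! ## §3 Uniqueness against Clay competitors and the `ν`-instance of (C) -/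

/-- **A global Clay-class solution with the same datum and force coincides with the design on
`[0, T)`** (PATH B′: `clay_competitor_eq_of_serrinClass_B` on the closed slab `[0, t']`, `t < t' < T`,
where the design is classical, of finite energy and in `L⁴L⁶`). No named fact. [cite: Sohr2001, Thm. V.1.5.1] -/
theorem eq_of_claySolution (hν : 0 < ν)
    {v : ℝ → EuclideanSpace ℝ (Fin 3) → EuclideanSpace ℝ (Fin 3)}
    {q : ℝ → EuclideanSpace ℝ (Fin 3) → ℝ}
    (hv : IsSmoothOnHalfSpace v) (hq : IsSmoothOnHalfSpace q)
    (hns : IsNavierStokesSolution ν D.f (D.u 0) v q) (hE : HasBoundedEnergy v) :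
    ∀ t ∈ Ico 0 D.T, v t = D.u t := by
  intro t ht
  obtain ⟨ht0, htT⟩ := ht
  obtain ⟨t', htt', ht'T⟩ := exists_between htT
  have ht'0 : 0 < t' := lt_of_le_of_lt ht0 htt'
  have hu' : IsClassicalNSSolutionOn (Icc 0 t') ν D.f D.u D.p :=
    D.classical.mono (fun s hs => ⟨hs.1, lt_of_le_of_lt hs.2 ht'T⟩) (uniqueDiffOn_Icc ht'0)
  have hEu : ∃ C : ℝ≥0∞, C < ⊤ ∧ ∀ s ∈ Icc 0 t', ∫⁻ x, ‖D.u s x‖ₑ ^ 2 ≤ C := D.energy t' ht'T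
  have hS : ∀ T', 0 < T' → T' < t' → MemLqLp 4 6 D.u (Ioo 0 T') :=
    fun T' _ hT' => D.memLqLp_four_six ht'T hT'.le
  exact clay_competitor_eq_of_serrinClass_B hν ht'0 D.force_smooth D.force_decay hu' hEu hS
    hns hv hq hE t ⟨ht0, htt'.le⟩

/-- **No global Clay-class solution shares the datum and force of a designed blow-up**: such a
solution would coincide with the design on `[0, T)` (`eq_of_claySolution`), so its restriction to
`[0, T+1)` is a classical extension of the design past `T`, which `no_extension` forbids.
[cite: FeffermanClay2006, (C)] -/
theorem not_exists_claySolution (hν : 0 < ν) :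
    ¬ ∃ (v : ℝ → EuclideanSpace ℝ (Fin 3) → EuclideanSpace ℝ (Fin 3))
        (q : ℝ → EuclideanSpace ℝ (Fin 3) → ℝ),
        IsSmoothOnHalfSpace v ∧ IsSmoothOnHalfSpace q ∧
          IsNavierStokesSolution ν D.f (D.u 0) v q ∧ HasBoundedEnergy v := by
  rintro ⟨v, q, hv, hq, hns, hE⟩
  have heq : ∀ t ∈ Ico 0 D.T, v t = D.u t := D.eq_of_claySolution hν hv hq hns hE
  have hclv : IsClassicalNSSolutionOn (Ici 0) ν D.f v q :=
    (isNavierStokesSolution_and_smooth_iff.1 ⟨hns, hv, hq⟩).1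
  have hT1 : D.T < D.T + 1 := by linarith
  have hclv' : IsClassicalNSSolutionOn (Ico 0 (D.T + 1)) ν D.f v q :=
    hclv.mono (fun s hs => hs.1) (uniqueDiffOn_Ico 0 (D.T + 1))
  exact D.no_extension ⟨D.T + 1, hT1, v, q, hclv', heq⟩

/-- **The `ν`-instance of Fefferman's (C) from ONE designed blow-up at viscosity `ν`.**
[cite: FeffermanClay2006, (C)] -/
theorem clay_breakdown_at (D : DesignedBlowup ν) (hν : 0 < ν) :
    ∃ (u₀ : EuclideanSpace ℝ (Fin 3) → EuclideanSpace ℝ (Fin 3))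
      (f : ℝ → EuclideanSpace ℝ (Fin 3) → EuclideanSpace ℝ (Fin 3)),
      ContDiff ℝ ∞ u₀ ∧ NSWave0.IsDivFree u₀ ∧ HasRapidSpatialDecay u₀ ∧
      IsSmoothOnHalfSpace f ∧ HasRapidSpaceTimeDecay f ∧
        ¬ ∃ (u : ℝ → EuclideanSpace ℝ (Fin 3) → EuclideanSpace ℝ (Fin 3))
            (p : ℝ → EuclideanSpace ℝ (Fin 3) → ℝ),
            IsSmoothOnHalfSpace u ∧ IsSmoothOnHalfSpace p ∧
              IsNavierStokesSolution ν f u₀ u p ∧ HasBoundedEnergy u :=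
  ⟨D.u 0, D.f, D.contDiff_datum, D.divFree_datum, D.datum_decay, D.force_smooth, D.force_decay,
    D.not_exists_claySolution hν⟩

/-! ## §4 One viscosity gives all -/

/-- Dilating twice with reciprocal factors is the identity (`a ≠ 0`, amplitudes `c`, `c'` with
`c' * c = 1`). [folklore] -/
theorem timeRescale_timeRescale_of_mul_eq_one {X F : Type*} [NormedAddCommGroup X] [NormedSpace ℝ X]
    [NormedAddCommGroup F] [NormedSpace ℝ F] {a b c c' : ℝ} (hab : b * a = 1) (hc : c' * c = 1)
    (w : ℝ → X → F) : timeRescale b c' (timeRescale a c w) = w := by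
  funext s x
  simp only [timeRescale_apply, smul_smul, hc, one_smul, ← mul_assoc, mul_comm a b, hab, one_mul]

/-- **Change of viscosity for designed blow-ups.** A designed blow-up at viscosity `μ > 0` yields one
at any `ν > 0`: with `a = ν/μ`, `u ↦ a·u(a t, x)`, `p ↦ a²·p(a t, x)`, `f ↦ a²·f(a t, x)`,
`T ↦ T/a` (tree `isClassicalNSSolutionOn_viscosityChange`); Clay classes, slab energies and slab
bounds are preserved (`hasRapidSpatialDecay_const_smul`, `hasRapidSpaceTimeDecay_timeRescale`,
`isSmoothOnHalfSpace_timeRescale`, `lintegral_enorm_sq_const_smul`), and an extension of the dilated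
solution past `T/a` would dilate back (factor `a⁻¹`) to an extension of the original past `T`.
[cite: Tao2011, footnote 3] -/
def rescale {μ : ℝ} (D : DesignedBlowup μ) (hμ : 0 < μ) (hν : 0 < ν) : DesignedBlowup ν :=
  let a : ℝ := ν / μ
  have ha : 0 < a := div_pos hν hμ
  have haμ : a * μ = ν := div_mul_cancel₀ ν hμ.ne'
  have hmaps : MapsTo (fun s => a * s) (Ico (0 : ℝ) (D.T / a)) (Ico 0 D.T) := fun s hs =>
    ⟨mul_nonneg ha.le hs.1, by
      have := mul_lt_mul_of_pos_left hs.2 ha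
      rwa [mul_div_cancel₀ _ ha.ne'] at this⟩
  { T := D.T / a
    T_pos := div_pos D.T_pos ha
    u := timeRescale a a D.u
    p := timeRescale a (a ^ 2) D.p
    f := timeRescale a (a ^ 2) D.f
    classical := by
      have h := isClassicalNSSolutionOn_viscosityChange D.classical a hmaps
        (uniqueDiffOn_Ico 0 (D.T / a))
      rwa [haμ] at h
    no_extension := by
      rintro ⟨T', hT', u', p', hcl', heq⟩
      -- dilate the extension back with the factor `b = a⁻¹`
      set b : ℝ := a⁻¹ with hb
      have hb0 : 0 < b := inv_pos.2 ha
      have hba : b * a = 1 := inv_mul_cancel₀ ha.ne'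
      have hmaps' : MapsTo (fun s => b * s) (Ico (0 : ℝ) (a * T')) (Ico 0 T') := fun s hs =>
        ⟨mul_nonneg hb0.le hs.1, by
          have := mul_lt_mul_of_pos_left hs.2 hb0
          rwa [← mul_assoc, hba, one_mul] at this⟩
      have hcl'' := isClassicalNSSolutionOn_viscosityChange hcl' b hmaps' (uniqueDiffOn_Ico 0 (a * T'))
      have hbν : b * ν = μ := by
        rw [← haμ, ← mul_assoc, hba, one_mul]
      rw [hbν] at hcl''
      have hff : timeRescale b (b ^ 2) (timeRescale a (a ^ 2) D.f) = D.f :=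
        timeRescale_timeRescale_of_mul_eq_one hba (by rw [← mul_pow, hba, one_pow]) D.f
      rw [hff] at hcl''
      refine D.no_extension ⟨a * T', ?_, timeRescale b b u', timeRescale b (b ^ 2) p', hcl'', ?_⟩
      · have := mul_lt_mul_of_pos_left hT' ha
        rwa [mul_div_cancel₀ _ ha.ne'] at this
      · intro t ht
        have hbt : b * t ∈ Ico 0 (D.T / a) := by
          refine ⟨mul_nonneg hb0.le ht.1, ?_⟩
          rw [hb, div_eq_inv_mul]
          exact mul_lt_mul_of_pos_left ht.2 hb0
        rw [timeRescale_slice, heq (b * t) hbt, ← timeRescale_slice,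
          timeRescale_timeRescale_of_mul_eq_one hba hba D.u]
    datum_decay := by
      rw [timeRescale_zero]
      exact hasRapidSpatialDecay_const_smul D.datum_decay D.contDiff_datum a
    force_smooth := isSmoothOnHalfSpace_timeRescale D.force_smooth ha.le _
    force_decay := hasRapidSpaceTimeDecay_timeRescale D.force_smooth D.force_decay ha _
    energy := by
      intro T' hT'
      have haT' : a * T' < D.T := by
        have := mul_lt_mul_of_pos_left hT' ha
        rwa [mul_div_cancel₀ _ ha.ne'] at this
      obtain ⟨C, hC, hbd⟩ := D.energy (a * T') haT'
      refine ⟨ENNReal.ofReal (a ^ 2) * C, ENNReal.mul_lt_top ENNReal.ofReal_lt_top hC,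
        fun t ht => ?_⟩
      simp only [timeRescale_apply]
      rw [lintegral_enorm_sq_const_smul]
      exact mul_le_mul_right (hbd (a * t) ⟨mul_nonneg ha.le ht.1,
        mul_le_mul_of_nonneg_left ht.2 ha.le⟩) _
    bounded := by
      intro T' hT'
      have haT' : a * T' < D.T := by
        have := mul_lt_mul_of_pos_left hT' ha
        rwa [mul_div_cancel₀ _ ha.ne'] at this
      obtain ⟨B, hB⟩ := D.bounded (a * T') haT'
      refine ⟨a * B, fun t ht x => ?_⟩
      rw [timeRescale_apply, norm_smul, Real.norm_of_nonneg ha.le]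
      exact mul_le_mul_of_nonneg_left
        (hB (a * t) ⟨mul_nonneg ha.le ht.1, mul_le_mul_of_nonneg_left ht.2 ha.le⟩ x) ha.le }

/-! ## §5 The pointwise blow-up witness -/

/-- **Unboundedness on a compact box forbids any classical extension past `T`.** If `u` is
unbounded on `[0, T) × K` for a compact `K ⊆ ℝ³` (every designed singularity has this shape: a
floor `|u(t_k, x_k)| → ∞` at points of a fixed ball), then no classical solution on a longer slab
`[0, T')` agrees with `u` on `[0, T)`: it would be jointly continuous, hence bounded, on the compact
box `[0, T] × K`. (Compactness only.) [folklore] -/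
theorem not_hasSmoothExtensionPast_of_unboundedOn {ν T : ℝ}
    {f u : ℝ → EuclideanSpace ℝ (Fin 3) → EuclideanSpace ℝ (Fin 3)}
    {K : Set (EuclideanSpace ℝ (Fin 3))} (hK : IsCompact K)
    (hub : ∀ M : ℝ, ∃ t ∈ Ico 0 T, ∃ x ∈ K, M < ‖u t x‖) :
    ¬ HasSmoothExtensionPast ν f u T := by
  rintro ⟨T', hT', u', p', hcl', heq⟩
  set Kb : Set (ℝ × EuclideanSpace ℝ (Fin 3)) := Icc (0 : ℝ) T ×ˢ K with hKb
  have hKc : IsCompact Kb := isCompact_Icc.prod hK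
  have hsub : Kb ⊆ Ico (0 : ℝ) T' ×ˢ (univ : Set (EuclideanSpace ℝ (Fin 3))) :=
    prod_mono (fun s hs => ⟨hs.1, lt_of_le_of_lt hs.2 hT'⟩) (subset_univ _)
  have hcont : ContinuousOn (uncurry u') Kb :=
    (ContDiffOn.continuousOn hcl'.smooth_velocity).mono hsub
  obtain ⟨M, hM⟩ := hKc.exists_bound_of_continuousOn hcont
  obtain ⟨t, ht, x, hx, hlt⟩ := hub M
  have hmem : (t, x) ∈ Kb := mk_mem_prod ⟨ht.1, ht.2.le⟩ hx
  have hb := hM _ hmem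
  simp only [uncurry_apply_pair, heq t ht] at hb
  exact absurd hlt (not_lt.2 hb)

/-- **Constructor from a pointwise blow-up witness**: the fields of `DesignedBlowup` with
`no_extension` replaced by «`u` unbounded on `[0, T) × K`, `K` compact». [folklore] -/
def ofUnboundedOn {ν : ℝ} (T : ℝ) (T_pos : 0 < T)
    (u : ℝ → EuclideanSpace ℝ (Fin 3) → EuclideanSpace ℝ (Fin 3))
    (p : ℝ → EuclideanSpace ℝ (Fin 3) → ℝ)
    (f : ℝ → EuclideanSpace ℝ (Fin 3) → EuclideanSpace ℝ (Fin 3))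
    (classical : IsClassicalNSSolutionOn (Ico 0 T) ν f u p)
    (K : Set (EuclideanSpace ℝ (Fin 3))) (hK : IsCompact K)
    (unbounded : ∀ M : ℝ, ∃ t ∈ Ico 0 T, ∃ x ∈ K, M < ‖u t x‖)
    (datum_decay : HasRapidSpatialDecay (u 0)) (force_smooth : IsSmoothOnHalfSpace f)
    (force_decay : HasRapidSpaceTimeDecay f)
    (energy : ∀ T', T' < T → ∃ C : ℝ≥0∞, C < ⊤ ∧ ∀ t ∈ Icc 0 T', ∫⁻ x, ‖u t x‖ₑ ^ 2 ≤ C)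
    (bounded : ∀ T', T' < T → ∃ B : ℝ, ∀ t ∈ Icc 0 T', ∀ x, ‖u t x‖ ≤ B) : DesignedBlowup ν where
  T := T
  T_pos := T_pos
  u := u
  p := p
  f := f
  classical := classical
  no_extension := not_hasSmoothExtensionPast_of_unboundedOn hK unbounded
  datum_decay := datum_decay
  force_smooth := force_smooth
  force_decay := force_decay
  energy := energy
  bounded := bounded

end DesignedBlowup

/-! ## §6 The closer -/

/-- **THE GENERIC E–C CLOSER: one designed forced blow-up, at one viscosity, gives Fefferman's (C).**
At the given `μ` by `DesignedBlowup.clay_breakdown_at`; at every other `ν > 0` after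
`DesignedBlowup.rescale`. Conditional on the inhabitant only (none is asserted).
[cite: FeffermanClay2006, (C)] [cite: Tao2011, footnote 3] -/
theorem navierStokesBreakdownR3_of_designedBlowup {μ : ℝ} (hμ : 0 < μ) (D : DesignedBlowup μ) :
    Summit.NavierStokesRegularity.NavierStokesRegularity.NavierStokesBreakdownR3 :=
  fun _ν hν => (D.rescale hμ hν).clay_breakdown_at hν

/-- The `∀ ν` form: designed blow-ups at every viscosity give (C) (no rescaling needed).
[cite: FeffermanClay2006, (C)] -/
theorem navierStokesBreakdownR3_of_forall_designedBlowup (h : ∀ ν : ℝ, 0 < ν → Nonempty (DesignedBlowup ν)) :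
    Summit.NavierStokesRegularity.NavierStokesRegularity.NavierStokesBreakdownR3 := by
  intro ν hν
  obtain ⟨D⟩ := h ν hν
  exact D.clay_breakdown_at hν

/-- Literature spelling of (C) (`Literature.Analysis.FluidPDE.NavierStokesBreakdownR3`, verbatim the
summit-side leaf). [cite: FeffermanClay2006, (C)] -/
theorem literature_navierStokesBreakdownR3_of_designedBlowup {μ : ℝ} (hμ : 0 < μ)
    (D : DesignedBlowup μ) : Literature.Analysis.FluidPDE.NavierStokesBreakdownR3 :=
  navierStokesBreakdownR3_iff_literature.1 (navierStokesBreakdownR3_of_designedBlowup hμ D)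

/-! ## §7 The tower interface factors through the generic closer -/

namespace PalasekTowerClayBridge.Realisation

variable {ν : ℝ} {R : TowerRates} (W : Realisation ν R)

/-- **A realised Palasek tower is a designed blow-up** (its maximality is the tree's
`Realisation.isMaximalSmoothSolution`, its slab bounds are the ceilings, `Realisation.norm_le_of_lt`).
[cite: Palasek2026ElementaryModel, §4] -/
def toDesignedBlowup : DesignedBlowup ν where
  T := W.T
  T_pos := W.T_pos
  u := W.u
  p := W.p
  f := W.f
  classical := W.classical
  no_extension := W.isMaximalSmoothSolution.2
  datum_decay := W.datum_decay
  force_smooth := W.force_smooth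
  force_decay := W.force_decay
  energy := W.energy
  bounded := fun _T' hT' => W.norm_le_of_lt hT'

end PalasekTowerClayBridge.Realisation

/-- **The E–C bridge of record, re-derived through the generic closer**: `PalasekStep2 R → (C)`
(same content as `PalasekTowerClayBridge.navierStokesBreakdownR3_of_step2_B`; here via
`Realisation.toDesignedBlowup`). [cite: FeffermanClay2006, (C)] [cite: Palasek2026ElementaryModel, §4] -/
theorem navierStokesBreakdownR3_of_step2_designed (R : PalasekTowerClayBridge.TowerRates)
    (h : PalasekTowerClayBridge.PalasekStep2 R) :
    Summit.NavierStokesRegularity.NavierStokesRegularity.NavierStokesBreakdownR3 := by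
  intro ν hν
  obtain ⟨W⟩ := h ν hν
  exact W.toDesignedBlowup.clay_breakdown_at hν

end Summit.NavierStokesRegularity.FluidComputer

end
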